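import Mathlib
import Summits.ValiantsHypothesis.ValiantsHypothesis.Theses.ValuativeGCT

/-!
# Growth gap (B5)

Stub `stub_growthGap` of line `skew-restriction-rank` for crux `ValuativeGCT.ValuativeFlip`
(stmt-ValiantsHypothesis-12624), bottom-of-the-window decomposition (second lead, 2026-08-16).

Pure natural-number arithmetic: a polynomial of degree `z` in `δ` is eventually beaten by the
binomial coefficient `Nat.choose (δ + N) N`, which is a polynomial of degree `N ≥ z + 1` in `δ`.
We exhibit the explicit witness `δ := (n + 1) ^ z * N !`.

-/

set_option linter.dupNamespace false

namespace Summit.ValiantsHypothesis.ValiantsHypothesis.Theorems.ValuativeFlip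

open MvPolynomial
open scoped BigOperators Matrix
open Literature.NumberTheory.DiophantineGeometry
open Literature.Computability.AlgebraicComplexity

noncomputable section

/-- **Growth gap (B5).** For natural numbers `n z N` with `z + 1 ≤ N` there is a `δ : ℕ` with
`(n * δ + 1) ^ z < Nat.choose (δ + N) N`: polynomial growth of degree `z` loses to the binomial
coefficient `C(δ + N, N)`, of degree `N ≥ z + 1` in `δ`.

Proof: take `δ := (n + 1) ^ z * N !`.  From `(δ + N)! = C(δ + N, N) * δ! * N!`
(`Nat.add_choose_mul_factorial_mul_factorial`) and `δ! * (δ + 1) ^ N ≤ (δ + N)!`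
(`Nat.factorial_mul_pow_le_factorial`) we get `(δ + 1) ^ N ≤ C(δ + N, N) * N!`; on the other
side `(n * δ + 1) ^ z * N! ≤ (n + 1) ^ z * (δ + 1) ^ z * N! = δ * (δ + 1) ^ z < (δ + 1) ^ (z + 1)
≤ (δ + 1) ^ N`, and we cancel `N! > 0`.  Used by the glue of line `skew-restriction-rank` with
`z = n⁴ - 2n² + 2n`, `N = n⁴ - n² - 1` (Hilbert-function count at the bottom of the
Mulmuley–Sohoni window). -/
theorem stub_growthGap (n z N : ℕ) (h : z + 1 ≤ N) :
    ∃ δ : ℕ, (n * δ + 1) ^ z < Nat.choose (δ + N) N := by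
  obtain ⟨δ, hδ⟩ : ∃ δ : ℕ, δ = (n + 1) ^ z * N.factorial := ⟨_, rfl⟩
  refine ⟨δ, ?_⟩
  have hδpos : 0 < δ.factorial := Nat.factorial_pos δ
  -- (δ+1)^N ≤ C(δ+N, N) * N!
  have h1 : (δ + 1) ^ N ≤ Nat.choose (δ + N) N * N.factorial := by
    have hA : (δ + N).choose N * δ.factorial * N.factorial = (δ + N).factorial :=
      Nat.add_choose_mul_factorial_mul_factorial δ N
    have hB : δ.factorial * (δ + 1) ^ N ≤ (δ + N).factorial :=
      Nat.factorial_mul_pow_le_factorial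
    have hC : δ.factorial * (δ + 1) ^ N ≤ δ.factorial * (Nat.choose (δ + N) N * N.factorial) :=
      calc δ.factorial * (δ + 1) ^ N ≤ (δ + N).factorial := hB
        _ = (δ + N).choose N * δ.factorial * N.factorial := hA.symm
        _ = δ.factorial * (Nat.choose (δ + N) N * N.factorial) := by ring
    exact Nat.le_of_mul_le_mul_left hC hδpos
  -- (nδ+1)^z ≤ (n+1)^z (δ+1)^z
  have h2 : (n * δ + 1) ^ z ≤ (n + 1) ^ z * (δ + 1) ^ z := by
    rw [← mul_pow]
    exact Nat.pow_le_pow_left (by nlinarith) z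
  have h3 : (n * δ + 1) ^ z * N.factorial < Nat.choose (δ + N) N * N.factorial :=
    calc (n * δ + 1) ^ z * N.factorial ≤ (n + 1) ^ z * (δ + 1) ^ z * N.factorial :=
          Nat.mul_le_mul_right _ h2
      _ = δ * (δ + 1) ^ z := by rw [hδ]; ring
      _ < (δ + 1) * (δ + 1) ^ z :=
          Nat.mul_lt_mul_of_pos_right (Nat.lt_succ_self δ) (by positivity)
      _ = (δ + 1) ^ (z + 1) := by ring
      _ ≤ (δ + 1) ^ N := Nat.pow_le_pow_right (Nat.succ_pos δ) h
      _ ≤ Nat.choose (δ + N) N * N.factorial := h1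
  exact Nat.lt_of_mul_lt_mul_right h3

end

end Summit.ValiantsHypothesis.ValiantsHypothesis.Theorems.ValuativeFlip
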